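import Summits.ResolutionOfSingularities.ResolutionOfSingularities.Theorems.FrobeniusClosingSteerCore4CompositeRankConcl
import Summits.ResolutionOfSingularities.ResolutionOfSingularities.Theorems.ValuativeLupiTranscendentalAscent
import Literature.AlgebraicGeometry.Resolution.AffineDomainDimension
import HarnessLib

/-!
# Steer (W4.1): `Concl` of a CYLINDER datum follows from torsor LU below — the admissibility lemma

OURS (campaign res-hironaka, rung L, slot W4.1, crux `Steer` stmt-ResolutionOfSingularities-16345, line
`switching_dichotomy` r12; proposed by the ideator seat res-L0-w41-idea-2 g3 as «lemma `concl_of_cylinder`, size M»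
in its CYLINDER CALIBRATION (STATUS 2026-08-27T03:55:44Z (B)); typed and proved by the prover seat res-type-028).
NOT a statement of the manuscript under review; AI-produced, weaker than expert review.

## What it says

The frontier stubs of line `switching_dichotomy` carry the induction hypothesis
`TorsorLUZeroDimBelow p n` (torsor local uniformization at zero-dimensional valuations in transcendence degree
`< n`) and conclude `Concl O A₀ t` (a finitely generated model `A₀[t] ⊆ A ⊆ O` of `K`, regular at the centre of
`O`).  A datum `(O, A₀, t)` is a **cylinder** over a sub-datum `(OL, B₀, τ)` living in a subfield `L ⊆ K`
(`OL = O ∩ L`, `Frac (B₀[τ]) = L`, `τ ^ p ∈ B₀`) when `A₀ ⊆ B₀[y]` and `t ∈ B₀[τ][y]` for finitely many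
elements `y₁, …, yₘ ∈ O` with `trdeg_k L + m ≤ trdeg_k K` (so `y` is a transcendence basis of `K` over `L`).
**Theorem `concl_of_subdatum`:** for such a datum, `ZeroDim k O`, `trdeg_k L < n`, regularity of `B₀` at the
centre of `OL` and `TorsorLUZeroDimBelow p n` imply `Concl O A₀ t` — restrict to `L` (the restriction of a
zero-dimensional valuation ring is zero-dimensional, `zeroDim_of_subfield`), take the regular model
`B ⊆ OL` handed by the induction hypothesis, and adjoin `y`: `A := B[y] ≅ B[X₁, …, Xₘ]` is regular at the
centre of `O` because regularity ascends along polynomial extensions prime by prime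
(`Theorems.Lupi.isRegularLocalRing_localization_mvPolynomial`: Serre + Mathlib's
`MvPolynomial.isRegularRing_of_isRegularRing`).  Consequence drawn by the ideator (paper level, not formalised
here): the test radicands in play on the W4.1 desk (`y₁y₂ + y₃^(p+1)`, the `y₄`-free `W_far`, tri-2's
`(y₂ - y₁²)² + y₃y₄ + y₁³` in characteristic `3`, K4.1c's `y₀y₁ + y₁³`) are cylinders over torsor hypersurfaces of
dimension `≤ 3`, hence satisfy `Concl` from the stubs' own antecedent and cannot test the crux.

Vocabulary of the registered skeleton (`Steer_r12.lean` 0afe4d277ab71637): `Concl` is the landed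
`Theorems.SteerRankThinness.Concl` (p493665); `ZeroDim` and `TorsorLUZeroDimBelow` are INLINED verbatim below, so the
skeleton consumes the theorem by definitional unfolding.
-/

-- single-problem summit: the doubled namespace component `ResolutionOfSingularities` is forced
set_option linter.dupNamespace false

namespace Summit.ResolutionOfSingularities.ResolutionOfSingularities.Theorems.SteerCylinder

open IsLocalRing
open Literature.AlgebraicGeometry.Resolution
open Summit.ResolutionOfSingularities.ResolutionOfSingularities.Theorems.SteerRankThinness (Concl)

/-! ## Vocabulary (verbatim line `switching_dichotomy` r12) -/

section Vocabulary

variable {k K : Type} [Field k] [Field K] [Algebra k K]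

variable (k) in
/-- `O` is zero-dimensional over `k`: every element of `O` is a root modulo `𝔪_O` of a non-zero
polynomial over `k` (residue field algebraic over `k`; Zariski–Samuel, Ch. VI §17). Verbatim r12 `ZeroDim`.
[folklore] -/
def ZeroDim (O : ValuationSubring K) : Prop :=
  ∀ x ∈ O, ∃ f : Polynomial k, f ≠ 0 ∧ Polynomial.aeval x f ∈ O.nonunits

end Vocabulary

/-- Torsor LU at zero-dimensional valuation rings over perfect fields of characteristic `p`, for all
data of transcendence degree `< n` — the induction hypothesis handed to the frontier stubs. Verbatim r12
`TorsorLUZeroDimBelow` (with `Concl` = `Theorems.SteerRankThinness.Concl`, same body). [folklore] -/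
def TorsorLUZeroDimBelow (p n : ℕ) : Prop :=
  ∀ (k K : Type) [Field k] [CharP k p] [PerfectField k] [Field K] [Algebra k K]
    (O : ValuationSubring K) (A₀ : Subalgebra k K) (h₀ : A₀.toSubring ≤ O.toSubring) (t : K),
    Algebra.trdeg k K < (n : Cardinal) → ZeroDim k O →
    A₀.FG → t ^ p ∈ A₀ → IsFractionRing (Algebra.adjoin k (insert t (A₀ : Set K))) K →
    IsRegularLocalRing (Localization.AtPrime
      (Ideal.comap (Subring.inclusion h₀) (IsLocalRing.maximalIdeal O))) → Concl O A₀ t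

/-! ## §1 Restricting a valuation ring to a subfield: nonunits and zero-dimensionality -/

section Restrict

variable {k K L : Type} [Field k] [Field K] [Algebra k K] [Field L] [Algebra k L]

/-- Membership-only description of the nonunits of a valuation ring: `x ∈ O` is a nonunit iff
`x = 0` or `x⁻¹ ∉ O`. [folklore] -/
theorem mem_nonunits_iff_eq_zero_or_inv_not_mem (O : ValuationSubring K) {x : K} (hx : x ∈ O) :
    x ∈ O.nonunits ↔ x = 0 ∨ x⁻¹ ∉ O := by
  rw [ValuationSubring.mem_nonunits_iff]
  by_cases h0 : x = 0
  · subst h0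
    simp
  · rw [← ValuationSubring.valuation_le_one_iff, not_le,
      Valuation.one_lt_val_iff O.valuation (inv_ne_zero h0), inv_inv]
    simp [h0]

/-- Along a field homomorphism `φ : L → K` with `OL = φ⁻¹ O`, nonunits correspond. [folklore] -/
theorem map_mem_nonunits_iff (φ : L →+* K) (OL : ValuationSubring L) (O : ValuationSubring K)
    (hOL : ∀ x, x ∈ OL ↔ φ x ∈ O) {x : L} (hx : x ∈ OL) :
    φ x ∈ O.nonunits ↔ x ∈ OL.nonunits := by
  rw [mem_nonunits_iff_eq_zero_or_inv_not_mem O ((hOL x).mp hx),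
    mem_nonunits_iff_eq_zero_or_inv_not_mem OL hx, map_eq_zero, ← map_inv₀, ← hOL]

/-- In the local rings: `⟨φ x, _⟩ ∈ 𝔪_O ↔ ⟨x, _⟩ ∈ 𝔪_{OL}`. [folklore] -/
theorem mem_maximalIdeal_iff_of_map (φ : L →+* K) (OL : ValuationSubring L) (O : ValuationSubring K)
    (hOL : ∀ x, x ∈ OL ↔ φ x ∈ O) {x : L} (hx : x ∈ OL) (hφx : φ x ∈ O) :
    (⟨φ x, hφx⟩ : O) ∈ maximalIdeal O ↔ (⟨x, hx⟩ : OL) ∈ maximalIdeal OL := by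
  have h1 : φ x ∈ O.nonunits ↔ (⟨φ x, hφx⟩ : O) ∈ maximalIdeal O := by
    rw [ValuationSubring.mem_nonunits_iff_exists_mem_maximalIdeal]
    exact ⟨fun ⟨_, h⟩ => h, fun h => ⟨hφx, h⟩⟩
  have h2 : x ∈ OL.nonunits ↔ (⟨x, hx⟩ : OL) ∈ maximalIdeal OL := by
    rw [ValuationSubring.mem_nonunits_iff_exists_mem_maximalIdeal]
    exact ⟨fun ⟨_, h⟩ => h, fun h => ⟨hx, h⟩⟩
  rw [← h1, ← h2, map_mem_nonunits_iff φ OL O hOL hx]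

/-- **The restriction of a zero-dimensional valuation ring to a subfield is zero-dimensional**
(Zariski–Samuel, Ch. VI §17). [folklore] -/
theorem zeroDim_of_subfield (φ : L →ₐ[k] K) (OL : ValuationSubring L) (O : ValuationSubring K)
    (hOL : ∀ x, x ∈ OL ↔ φ x ∈ O) (hO : ZeroDim k O) : ZeroDim k OL := by
  intro x hx
  obtain ⟨f, hf0, hf⟩ := hO (φ x) ((hOL x).mp hx)
  refine ⟨f, hf0, ?_⟩
  rw [Polynomial.aeval_algHom_apply] at hf
  have hmem : Polynomial.aeval x f ∈ OL :=
    (hOL _).mpr (O.nonunits_subset hf)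
  exact (map_mem_nonunits_iff (φ : L →+* K) OL O hOL hmem).mp hf

end Restrict

/-! ## §2 Transport of "regular at the centre" along the subfield embedding -/

section Transport

variable {k K L : Type} [Field k] [Field K] [Algebra k K] [Field L] [Algebra k L]

/-- For a subalgebra `B ⊆ OL` of `L` and its isomorphic image `φ(B) ⊆ O` in `K` (`OL = φ⁻¹ O`), the
local ring of `φ(B)` at the centre of `O` is regular iff the local ring of `B` at the centre of `OL` is.
[folklore] -/
theorem isRegularLocalRing_centre_map_iff (φ : L →ₐ[k] K) (OL : ValuationSubring L)
    (O : ValuationSubring K) (hOL : ∀ x, x ∈ OL ↔ φ x ∈ O) (B : Subalgebra k L)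
    (hB : B.toSubring ≤ OL.toSubring) (hB' : (B.map φ).toSubring ≤ O.toSubring) :
    IsRegularLocalRing (Localization.AtPrime
        (Ideal.comap (Subring.inclusion hB') (maximalIdeal O))) ↔
      IsRegularLocalRing (Localization.AtPrime
        (Ideal.comap (Subring.inclusion hB) (maximalIdeal OL))) := by
  have hφ : Function.Injective φ := (φ : L →+* K).injective
  let e : B ≃ₐ[k] B.map φ := B.equivMapOfInjective φ hφ
  -- the centre of `O` on `φ(B)`, as an ideal of the subalgebra `φ(B)`
  let P : Ideal (B.map φ) := Ideal.comap (Subring.inclusion hB') (maximalIdeal O)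
  haveI hP : P.IsPrime := Ideal.comap_isPrime _ _
  -- the centre of `OL` on `B`, as an ideal of the subalgebra `B`
  let Q : Ideal B := Ideal.comap (Subring.inclusion hB) (maximalIdeal OL)
  haveI hQ : Q.IsPrime := Ideal.comap_isPrime _ _
  have hPQ : P.comap (e.toRingEquiv : B →+* B.map φ) = Q := by
    ext z
    simp only [Ideal.mem_comap, RingHom.coe_coe, P, Q]
    have hval : ((e.toRingEquiv z : B.map φ) : K) = φ z := by
      change ((B.equivMapOfInjective φ hφ z : B.map φ) : K) = φ z
      simp
    have h1 : Subring.inclusion hB' (e.toRingEquiv z) =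
        ⟨φ z, hB' (hval ▸ (e.toRingEquiv z).2)⟩ := Subtype.ext hval
    have h2 : Subring.inclusion hB z = ⟨(z : L), hB z.2⟩ := rfl
    rw [h1, h2]
    exact mem_maximalIdeal_iff_of_map (φ : L →+* K) OL O hOL (hB z.2) _
  have key := Lupi.isRegularLocalRing_localization_iff_of_ringEquiv e.toRingEquiv P
  haveI : (P.comap (e.toRingEquiv : B →+* B.map φ)).IsPrime := Ideal.comap_isPrime _ _
  have key2 : IsRegularLocalRing (Localization.AtPrime (P.comap (e.toRingEquiv : B →+* B.map φ))) ↔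
      IsRegularLocalRing (Localization.AtPrime Q) :=
    ⟨fun h => isRegularLocalRing_localization_atPrime_congr hPQ h,
      fun h => isRegularLocalRing_localization_atPrime_congr hPQ.symm h⟩
  exact key.trans key2

end Transport

/-! ## §3 Adjoining a transcendence basis to a model regular at the centre -/

section Ascent

variable {k K : Type} [Field k] [Field K] [Algebra k K]

/-- **Polynomial ascent of a regular model** (the `y' = y` case of
`Theorems.Lupi.isLocallyUniformizable_of_adjoin_model`, with the model made explicit). Let `O ⊇ k` be a
valuation ring of `K`, `B ⊆ O` a finitely generated `k`-subalgebra regular at the centre of `O`, and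
`y₁, …, yₘ ∈ O` with `k(B, y) = K` and `trdeg_k B + m ≤ trdeg_k K`. Then `B[y] ⊆ O` is finitely generated,
has fraction field `K`, and is regular at the centre of `O`: `y` is algebraically independent over `B`, so
`B[y] ≅ B[X₁, …, Xₘ]`, and regularity ascends along polynomial extensions prime by prime
(`Theorems.Lupi.isRegularLocalRing_localization_mvPolynomial`). [folklore] -/
theorem exists_model_adjoin (O : ValuationSubring K) (hk : ∀ c : k, algebraMap k K c ∈ O)
    (B : Subalgebra k K) (hB : B.toSubring ≤ O.toSubring) (hfg : B.FG)
    (hreg : IsRegularLocalRing (Localization.AtPrime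
      (Ideal.comap (Subring.inclusion hB) (IsLocalRing.maximalIdeal O))))
    {m : ℕ} (y : Fin m → K) (hyO : ∀ i, y i ∈ O)
    (htop : IntermediateField.adjoin k ((B : Set K) ∪ Set.range y) = ⊤)
    (hdim : Algebra.trdeg k B + m ≤ Algebra.trdeg k K) :
    ∃ (A : Subalgebra k K) (h : A.toSubring ≤ O.toSubring), B ≤ A ∧ (∀ i, y i ∈ A) ∧ A.FG ∧
      IsFractionRing A K ∧ IsRegularLocalRing (Localization.AtPrime
        (Ideal.comap (Subring.inclusion h) (IsLocalRing.maximalIdeal O))) := by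
  classical
  haveI : FaithfulSMul k K :=
    (faithfulSMul_iff_algebraMap_injective k K).mpr (algebraMap k K).injective
  haveI : FaithfulSMul B K :=
    (faithfulSMul_iff_algebraMap_injective B K).mpr Subtype.val_injective
  haveI : FaithfulSMul k B :=
    (faithfulSMul_iff_algebraMap_injective k B).mpr (algebraMap k B).injective
  haveI : Algebra.FiniteType k B := B.fg_iff_finiteType.mp hfg
  have hy : ∀ i, y i = y i ∨ y i = (y i)⁻¹ := fun i => Or.inl rfl
  haveI halg := Lupi.isAlgebraic_adjoin_of_eq_or_eq_inv B hy htop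
  -- ### `y` is algebraically independent over `B`
  have hind : AlgebraicIndependent B y := by
    refine (Algebra.IsAlgebraic.isTranscendenceBasis_of_le_trdeg_of_finite B y ?_).1
    rw [Cardinal.mk_fin]
    have hfin : Algebra.trdeg k B < Cardinal.aleph0 := trdeg_lt_aleph0
    have h := trdeg_add_eq k B (A := K)
    rw [← h, add_comm (Algebra.trdeg k B) (m : Cardinal), add_comm (Algebra.trdeg k B)] at hdim
    exact (Cardinal.add_le_add_iff_of_lt_aleph0 hfin).mp hdim
  -- ### the model `B' = k[s₀, y] = B[y]`
  obtain ⟨s₀, rfl⟩ := hfg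
  set B₁ : Subalgebra (Algebra.adjoin k (s₀ : Set K)) K :=
    Algebra.adjoin (Algebra.adjoin k (s₀ : Set K)) (Set.range y) with hB₁
  set B' : Subalgebra k K := Algebra.adjoin k ((s₀ : Set K) ∪ Set.range y) with hB'
  have hBB' : B' = B₁.restrictScalars k := Algebra.adjoin_union_eq_adjoin_adjoin k _ _
  have e : B'.toSubring = B₁.toSubring := by rw [hBB']; rfl
  have hyB' : ∀ i, y i ∈ B' := fun i => Algebra.subset_adjoin (Or.inr ⟨i, rfl⟩)
  have hs₀B' : (s₀ : Set K) ⊆ B' := fun z hz => Algebra.subset_adjoin (Or.inl hz)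
  have hA₀B' : Algebra.adjoin k (s₀ : Set K) ≤ B' := Algebra.adjoin_le hs₀B'
  -- `B' ⊆ O`
  have hB'O : B'.toSubring ≤ O.toSubring := by
    let Oalg : Subalgebra k K := { O.toSubring with algebraMap_mem' := hk }
    change B' ≤ Oalg
    refine Algebra.adjoin_le ?_
    rintro z (hz | ⟨i, rfl⟩)
    · exact hB (Algebra.subset_adjoin hz : z ∈ Algebra.adjoin k (s₀ : Set K))
    · exact hyO i
  have hB₁O : B₁.toSubring ≤ O.toSubring := e ▸ hB'O
  refine ⟨B', hB'O, hA₀B', hyB', ?_, ?_, ?_⟩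
  · -- `B'` is finitely generated
    refine ⟨s₀ ∪ Finset.univ.image y, ?_⟩
    rw [Finset.coe_union, Finset.coe_image, Finset.coe_univ, Set.image_univ]
  · -- `Frac B' = K`
    apply Lupi.isFractionRing_of_adjoin_eq_top
    apply top_le_iff.mp
    rw [← htop, IntermediateField.adjoin_le_iff]
    set F := IntermediateField.adjoin k ((B' : Subalgebra k K) : Set K) with hF
    have hB'F : ∀ z ∈ B', z ∈ F := fun z hz => IntermediateField.subset_adjoin k _ hz
    rintro z (hz | ⟨i, rfl⟩)
    · exact hB'F z (hA₀B' hz)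
    · exact hB'F _ (hyB' i)
  · -- ### regularity at the centre: transport to `B[X] = MvPolynomial (Fin m) B`
    refine isRegularLocalRing_centre_of_toSubring_eq O B' hB'O hB₁O e ?_
    set 𝔔 : Ideal B₁ := Ideal.comap (Subring.inclusion hB₁O) (IsLocalRing.maximalIdeal O) with h𝔔
    change IsRegularLocalRing (Localization.AtPrime 𝔔)
    let eB : MvPolynomial (Fin m) (Algebra.adjoin k (s₀ : Set K)) ≃+* B₁ := hind.aevalEquiv.toRingEquiv
    haveI : 𝔔.IsPrime := Ideal.comap_isPrime _ _
    refine (Lupi.isRegularLocalRing_localization_iff_of_ringEquiv eB 𝔔).mpr ?_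
    set Q : Ideal (MvPolynomial (Fin m) (Algebra.adjoin k (s₀ : Set K))) :=
      𝔔.comap (eB : MvPolynomial (Fin m) (Algebra.adjoin k (s₀ : Set K)) →+* B₁) with hQ
    haveI : Q.IsPrime := Ideal.comap_isPrime _ _
    apply Lupi.isRegularLocalRing_localization_mvPolynomial Q
    -- `Q ∩ B` is the centre of `O` on `B`
    have hQC : Q.comap (MvPolynomial.C : Algebra.adjoin k (s₀ : Set K) →+*
        MvPolynomial (Fin m) (Algebra.adjoin k (s₀ : Set K))) =
        Ideal.comap (Subring.inclusion hB) (IsLocalRing.maximalIdeal O) := by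
      ext a
      have hval : (Subring.inclusion hB₁O (eB (MvPolynomial.C a)) : K) = (a : K) := by
        change algebraMap B₁ K (hind.aevalEquiv (MvPolynomial.C a)) = (a : K)
        rw [hind.algebraMap_aevalEquiv, MvPolynomial.aeval_C]
        rfl
      have hval' : Subring.inclusion hB₁O (eB (MvPolynomial.C a)) = Subring.inclusion hB a :=
        Subtype.ext hval
      simp only [Ideal.mem_comap, hQ, h𝔔, RingHom.coe_coe]
      rw [hval']
    exact isRegularLocalRing_localization_atPrime_congr hQC.symm hreg

end Ascent

/-! ## §4 The admissibility lemma: `Concl` of a cylinder datum from torsor LU below -/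

section Main

variable {k K L : Type} [Field k] [Field K] [Algebra k K] [Field L] [Algebra k L]

/-- **`Concl` of a cylinder datum follows from torsor LU below** (res-L0-w41-idea-2's `concl_of_cylinder`,
two-level form). Data: a `k`-embedding of fields `φ : L → K`; a valuation ring `O` of `K`, zero-dimensional over
`k`, and its restriction `OL = φ⁻¹ O`; a SUB-DATUM `(OL, B₀, τ)` in `L` — `B₀ ⊆ OL` finitely generated and regular at
the centre of `OL`, `τ ^ p ∈ B₀`, `Frac (B₀[τ]) = L`, `trdeg_k L < n`; and elements `y₁, …, yₘ ∈ O` with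
`trdeg_k L + m ≤ trdeg_k K`. CONCLUSION: every datum `(O, A₀, t)` of `K` LYING OVER the cylinder —
`A₀ ⊆ φ(B₀)[y]`, `t ∈ φ(B₀)[φ τ][y]`, `Frac (A₀[t]) = K` — satisfies `Concl O A₀ t`, provided torsor LU holds at
zero-dimensional valuations in transcendence degree `< n` (`TorsorLUZeroDimBelow p n`, the induction hypothesis of
the frontier stubs). Proof: `OL` is zero-dimensional (`zeroDim_of_subfield`); the induction hypothesis gives a
finitely generated `B₀[τ] ⊆ B ⊆ OL` with `Frac B = L`, regular at the centre of `OL`; its image `φ(B) ⊆ O` is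
regular at the centre of `O` (`isRegularLocalRing_centre_map_iff`) with `trdeg_k φ(B) = trdeg_k L`; and
`A := φ(B)[y]` is the model sought (`exists_model_adjoin`). No regularity, finite generation or torsor property
of `A₀` itself is used. [folklore] -/
theorem concl_of_subdatum {p n : ℕ} (hBelow : TorsorLUZeroDimBelow p n) [CharP k p] [PerfectField k]
    (φ : L →ₐ[k] K) (O : ValuationSubring K) (hO : ZeroDim k O)
    (OL : ValuationSubring L) (hOL : ∀ x, x ∈ OL ↔ φ x ∈ O)
    (B₀ : Subalgebra k L) (h₀L : B₀.toSubring ≤ OL.toSubring) (hB₀ : B₀.FG) (τ : L)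
    (hτp : τ ^ p ∈ B₀) (hfracL : IsFractionRing (Algebra.adjoin k (insert τ (B₀ : Set L))) L)
    (hregL : IsRegularLocalRing (Localization.AtPrime
      (Ideal.comap (Subring.inclusion h₀L) (IsLocalRing.maximalIdeal OL))))
    (hn : Algebra.trdeg k L < (n : Cardinal))
    {m : ℕ} (y : Fin m → K) (hyO : ∀ i, y i ∈ O)
    (hdim : Algebra.trdeg k L + m ≤ Algebra.trdeg k K)
    (A₀ : Subalgebra k K) (hA₀ : A₀ ≤ Algebra.adjoin k (φ '' (B₀ : Set L) ∪ Set.range y))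
    (t : K) (ht : t ∈ Algebra.adjoin k (insert (φ τ) (φ '' (B₀ : Set L) ∪ Set.range y)))
    (hfrac : IsFractionRing (Algebra.adjoin k (insert t (A₀ : Set K))) K) :
    Concl O A₀ t := by
  classical
  -- constants lie in the valuation rings
  have hkL : ∀ c : k, algebraMap k L c ∈ OL := fun c => h₀L (B₀.algebraMap_mem c)
  have hk : ∀ c : k, algebraMap k K c ∈ O := fun c => by
    have h := (hOL _).mp (hkL c)
    rwa [AlgHom.commutes] at h
  -- ### Step 1: the sub-datum is zero-dimensional; apply the induction hypothesis in `L`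
  have hOLz : ZeroDim k OL := zeroDim_of_subfield φ OL O hOL hO
  have hc : Concl OL B₀ τ := hBelow k L OL B₀ h₀L τ hn hOLz hB₀ hτp hfracL hregL
  unfold Concl at hc
  obtain ⟨B, hBL, hB₀B, hτB, hBfg, hBfr, hBreg⟩ := hc
  -- ### Step 2: push the regular model `B ⊆ OL` forward to `K`
  have hB'O : (B.map φ).toSubring ≤ O.toSubring := by
    rintro _ ⟨z, hz, rfl⟩
    exact (hOL z).mp (hBL hz)
  have hB'fg : (B.map φ).FG := hBfg.map φ
  have hB'reg : IsRegularLocalRing (Localization.AtPrime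
      (Ideal.comap (Subring.inclusion hB'O) (IsLocalRing.maximalIdeal O))) :=
    (isRegularLocalRing_centre_map_iff φ OL O hOL B hBL hB'O).mpr hBreg
  have htrB' : Algebra.trdeg k (B.map φ) = Algebra.trdeg k L := by
    haveI := hBfr
    rw [trdeg_eq_trdeg_of_isFractionRing B]
    exact (AlgEquiv.trdeg_eq (B.equivMapOfInjective φ (φ : L →+* K).injective)).symm
  -- ### Step 3: `A₀[t] ⊆ φ(B)[y]`, hence `k(φ(B), y) = K`
  have hsub : Algebra.adjoin k (insert t (A₀ : Set K)) ≤
      Algebra.adjoin k (((B.map φ : Subalgebra k K) : Set K) ∪ Set.range y) := by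
    have hB₀B' : φ '' (B₀ : Set L) ⊆ ((B.map φ : Subalgebra k K) : Set K) := by
      rintro _ ⟨z, hz, rfl⟩
      exact ⟨z, hB₀B hz, rfl⟩
    have hτB' : φ τ ∈ B.map φ := ⟨τ, hτB, rfl⟩
    have h1 : Algebra.adjoin k (φ '' (B₀ : Set L) ∪ Set.range y) ≤
        Algebra.adjoin k (((B.map φ : Subalgebra k K) : Set K) ∪ Set.range y) :=
      Algebra.adjoin_mono (Set.union_subset_union_left _ hB₀B')
    have h2 : Algebra.adjoin k (insert (φ τ) (φ '' (B₀ : Set L) ∪ Set.range y)) ≤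
        Algebra.adjoin k (((B.map φ : Subalgebra k K) : Set K) ∪ Set.range y) :=
      Algebra.adjoin_le (Set.insert_subset_iff.mpr
        ⟨Algebra.subset_adjoin (Or.inl hτB'),
          (Set.union_subset_union_left _ hB₀B').trans Algebra.subset_adjoin⟩)
    exact Algebra.adjoin_le (Set.insert_subset_iff.mpr ⟨h2 ht, fun a ha => h1 (hA₀ ha)⟩)
  have htop : IntermediateField.adjoin k (((B.map φ : Subalgebra k K) : Set K) ∪ Set.range y) = ⊤ := by
    apply top_le_iff.mp
    intro z _
    haveI := hfrac
    obtain ⟨a, b, -, rfl⟩ :=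
      IsFractionRing.div_surjective (A := Algebra.adjoin k (insert t (A₀ : Set K))) z
    have hF : ∀ w ∈ Algebra.adjoin k (((B.map φ : Subalgebra k K) : Set K) ∪ Set.range y),
        w ∈ IntermediateField.adjoin k (((B.map φ : Subalgebra k K) : Set K) ∪ Set.range y) :=
      fun w hw => IntermediateField.algebra_adjoin_le_adjoin k _ hw
    exact div_mem (hF _ (hsub a.2)) (hF _ (hsub b.2))
  -- ### Step 4: adjoin `y` (polynomial ascent)
  have hdim' : Algebra.trdeg k (B.map φ) + m ≤ Algebra.trdeg k K := by
    rw [htrB']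
    exact hdim
  obtain ⟨A, hA, hB'A, hyA, hAfg, hAfr, hAreg⟩ :=
    exists_model_adjoin O hk (B.map φ) hB'O hB'fg hB'reg y hyO htop hdim'
  have hgen : Algebra.adjoin k (((B.map φ : Subalgebra k K) : Set K) ∪ Set.range y) ≤ A :=
    Algebra.adjoin_le (Set.union_subset_iff.mpr
      ⟨fun b hb => hB'A hb, by rintro _ ⟨i, rfl⟩; exact hyA i⟩)
  unfold Concl
  exact ⟨A, hA, fun a ha => hgen (hsub (Algebra.subset_adjoin (Set.mem_insert_of_mem t ha))),
    hgen (hsub (Algebra.subset_adjoin (Set.mem_insert t _))), hAfg, hAfr, hAreg⟩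

end Main

end Summit.ResolutionOfSingularities.ResolutionOfSingularities.Theorems.SteerCylinder
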